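import Mathlib
import Summits.PneNP.PneNP.Theses.OverlapGapAlgebra
import Summits.PneNP.PneNP.Theorems.OverlapGapAlgebraSearchHardWindowScanPaths
import Summits.PneNP.PneNP.Theorems.OverlapGapAlgebraSearchHardWindowSmoothMapsFail
import Summits.PneNP.PneNP.Theorems.OverlapGapAlgebraSearchHardWindowLowDegreeStability
import Literature.Probability.Moments.HoeffdingDecomposition
import Literature.Computability.Complexity.RandomKSatLowDegreeHardness

/-!
# Route OverlapGapAlgebra, crux `SearchHardWindow` (stmt-PneNP-2460): low-degree hardness with a
# CONSTANT failure probability, modulo `NoStableSection`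

**Theorem (`constLowDegreeHardness_of_noStableSection`).** Assume the route's probability crux
`NoStableSection` (stmt-PneNP-2462). There is `k₀` such that for every `k ≥ k₀` there is `δ > 0`
(depending on `k` only) with: for every energy constant `C`, every coordinate-degree sequence
`D_n = o(n / log² n)` and every sequence of vector-valued maps `F_n` on the literal arrays of
`F_k(n, ⌊5·2^k log k/k · n⌋)` with coordinate (Efron–Stein) degree `≤ D_n` and energy
`Σ_Φ ‖F_n(Φ)‖² ≤ C n · #Φ`, eventually the literal arrays `Φ` on which every `|F_n(Φ)_v| ≥ 1` AND the
sign assignment satisfies `Φ` number at most `(1 − δ) · #Φ`.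

This sits strictly between the tree's `weakLowDegreeHardness_of_noStableSection` (Bresler–Huang
2021 Thm. 2.6 type: failure probability `≥ c/log(2n)`, `D = o(n/log n)`) and the named fact
`HuangSellke2025KSat` (Huang–Sellke 2025 Cor. 3.21: success `o(1)`, `D = o(n)`): the failure
probability is bounded below by a constant independent of the degree and energy budgets.
Mechanism: the union-bound-free scan correlation inequality `scanCorrelation_paths` (the success
set pays `p^{k²m+1}`, stability a defect `exp(O(log n · √(D n)))`) against the `e^{−cn}` ceiling of
`NoStableSection`; with `p ≥ e^{−c/(4k²α)}` and `D = o(n/log² n)` the defect is `≤ cn/4` and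
`p^{k²m+1} ≥ e^{−cn/4 − o(n)}`, a contradiction.

References: G. Bresler, B. Huang, FOCS 2021 / arXiv:2106.02129, Thm. 2.6 [BreslerHuang2022];
B. Huang, M. Sellke, arXiv:2501.06427, Lemma 3.1, Cor. 3.21 [HuangSellke2025];
R. O'Donnell, *Analysis of Boolean Functions*, CUP 2014, §8.3–8.4 [ODonnell2014].
-/

namespace Summit.PneNP.PneNP.Theorems

set_option linter.dupNamespace false -- `Summit.PneNP.PneNP.…`: summit = sub-problem (D-0017)

open Finset Filter Asymptotics
open Summit.PneNP.PneNP.Theses.OverlapGapAlgebra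
open Literature.Computability.Complexity (IsCoordDegreeLE)
open Literature.Probability.Moments
open scoped Classical

/-- **Low coordinate degree ⇒ few large `L²`-jumps** (the stability budget, `L²` form). For
`F : instances → ℝⁿ` whose coordinates have coordinate degree `≤ D` in the `m·k` literal slots and
`η n > 0`, the number of (instance, slot, fresh literal) triples with
`Σ_v (F(Φ)_v − F(Φ')_v)² > η n` is at most `(4D/η) · Σ_Φ ‖F Φ‖²` (Markov and the
Hoeffding-decomposition bound `Literature.Probability.Moments.sum_sum_sum_sq_sub_update_le`:
total `L²`-influence `≤ 2D·(2n)·energy`). [ODonnell2014, §8.4; BreslerHuang2022, §6] -/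
theorem cld_farCount_le {m k n : ℕ} (hn : 1 ≤ n) {η : ℝ} (hη : 0 < η) {D : ℕ}
    (F : (Fin m → Fin k → Fin n × Bool) → Fin n → ℝ)
    (hdeg : ∀ v, IsCoordDegreeLE D (fun y : Fin m × Fin k → Fin n × Bool => F (Function.curry y) v)) :
    (∑ a : Fin m, ∑ b : Fin k,
        (((Finset.univ : Finset ((Fin m → Fin k → Fin n × Bool) × (Fin n × Bool))).filter
          fun p => η * n < ∑ v, (F p.1 v -
            F (Function.update p.1 a (Function.update (p.1 a) b p.2)) v) ^ 2).card : ℝ))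
      ≤ 4 * D / η * ∑ Φ : Fin m → Fin k → Fin n × Bool, ∑ v, F Φ v ^ 2 := by
  haveI : Nonempty (Fin n × Bool) := ⟨(⟨0, hn⟩, true)⟩
  have hn' : (0 : ℝ) < n := by exact_mod_cast hn
  have hηn : 0 < η * n := mul_pos hη hn'
  set f : Fin m → Fin k → (Fin m → Fin k → Fin n × Bool) × (Fin n × Bool) → Fin n → ℝ :=
    fun a b p v => (F p.1 v - F (Function.update p.1 a (Function.update (p.1 a) b p.2)) v) ^ 2
    with hf
  -- (1) Markov per slot
  have hslot : ∀ (a : Fin m) (b : Fin k),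
      (((Finset.univ : Finset ((Fin m → Fin k → Fin n × Bool) × (Fin n × Bool))).filter
          fun p => η * n < ∑ v, f a b p v).card : ℝ) ≤ (η * n)⁻¹ * ∑ p, ∑ v, f a b p v := by
    intro a b
    rw [Finset.card_filter, Nat.cast_sum, Finset.mul_sum]
    refine Finset.sum_le_sum fun p _ => ?_
    have h0 : 0 ≤ ∑ v, f a b p v := sum_nonneg fun v _ => by rw [hf]; exact sq_nonneg _
    split_ifs with hj
    · push_cast
      calc (1 : ℝ) = (η * n)⁻¹ * (η * n) := by rw [inv_mul_cancel₀ hηn.ne']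
        _ ≤ (η * n)⁻¹ * ∑ v, f a b p v := mul_le_mul_of_nonneg_left hj.le (inv_nonneg.2 hηn.le)
    · push_cast
      exact mul_nonneg (inv_nonneg.2 hηn.le) h0
  -- (2) the Hoeffding bound on the total squared movement, per output coordinate `v`
  have hcurry : ∀ (G : (Fin m → Fin k → Fin n × Bool) → ℝ),
      ∑ Φ, G Φ = ∑ y : Fin m × Fin k → Fin n × Bool, G (Function.curry y) := fun G =>
    (Fintype.sum_equiv (Equiv.curry _ _ _) _ _ fun _ => rfl).symm
  have hv : ∀ v : Fin n, ∑ a : Fin m, ∑ b : Fin k, ∑ Φ : Fin m → Fin k → Fin n × Bool,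
      ∑ ℓ : Fin n × Bool, (F Φ v - F (Function.update Φ a (Function.update (Φ a) b ℓ)) v) ^ 2 ≤
        2 * D * (2 * n) * ∑ Φ : Fin m → Fin k → Fin n × Bool, F Φ v ^ 2 := by
    intro v
    have h := sum_sum_sum_sq_sub_update_le (hdeg v)
    rw [Fintype.sum_prod_type] at h
    simp only [Function.curry_update] at h
    have e1 : ∀ (a : Fin m) (b : Fin k), ∑ y : Fin m × Fin k → Fin n × Bool, ∑ ℓ : Fin n × Bool,
        (F (Function.curry y) v -
          F (Function.update (Function.curry y) a (Function.update (Function.curry y a) b ℓ)) v) ^ 2 =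
        ∑ Φ : Fin m → Fin k → Fin n × Bool, ∑ ℓ : Fin n × Bool,
          (F Φ v - F (Function.update Φ a (Function.update (Φ a) b ℓ)) v) ^ 2 := fun a b =>
      (hcurry fun Φ => ∑ ℓ : Fin n × Bool,
        (F Φ v - F (Function.update Φ a (Function.update (Φ a) b ℓ)) v) ^ 2).symm
    have e2 : ∑ y : Fin m × Fin k → Fin n × Bool, F (Function.curry y) v ^ 2 =
        ∑ Φ : Fin m → Fin k → Fin n × Bool, F Φ v ^ 2 := (hcurry fun Φ => F Φ v ^ 2).symm
    simp only [e1, e2, Fintype.card_prod, Fintype.card_fin, Fintype.card_bool] at h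
    push_cast at h
    linarith
  have hhoef : ∑ a : Fin m, ∑ b : Fin k, ∑ p, ∑ v, f a b p v ≤
      2 * D * (2 * n) * ∑ Φ : Fin m → Fin k → Fin n × Bool, ∑ v, F Φ v ^ 2 := by
    calc ∑ a : Fin m, ∑ b : Fin k, ∑ p, ∑ v, f a b p v
        = ∑ a : Fin m, ∑ b : Fin k, ∑ v, ∑ p, f a b p v :=
          sum_congr rfl fun a _ => sum_congr rfl fun b _ => sum_comm
      _ = ∑ a : Fin m, ∑ v, ∑ b : Fin k, ∑ p, f a b p v := sum_congr rfl fun a _ => sum_comm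
      _ = ∑ v, ∑ a : Fin m, ∑ b : Fin k, ∑ p, f a b p v := sum_comm
      _ = ∑ v, ∑ a : Fin m, ∑ b : Fin k, ∑ Φ : Fin m → Fin k → Fin n × Bool,
            ∑ ℓ : Fin n × Bool, (F Φ v - F (Function.update Φ a (Function.update (Φ a) b ℓ)) v) ^ 2 := by
          simp only [hf, Fintype.sum_prod_type (f := fun p : (Fin m → Fin k → Fin n × Bool) ×
            (Fin n × Bool) => _)]
      _ ≤ ∑ v, 2 * D * (2 * n) * ∑ Φ : Fin m → Fin k → Fin n × Bool, F Φ v ^ 2 :=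
          sum_le_sum fun v _ => hv v
      _ = 2 * D * (2 * n) * ∑ Φ : Fin m → Fin k → Fin n × Bool, ∑ v, F Φ v ^ 2 := by
          rw [← mul_sum, sum_comm]
  -- (3) assemble
  calc _ ≤ ∑ a : Fin m, ∑ b : Fin k, (η * n)⁻¹ * ∑ p, ∑ v, f a b p v :=
        sum_le_sum fun a _ => sum_le_sum fun b _ => hslot a b
    _ = (η * n)⁻¹ * ∑ a : Fin m, ∑ b : Fin k, ∑ p, ∑ v, f a b p v := by
        simp only [← mul_sum]
    _ ≤ (η * n)⁻¹ * (2 * D * (2 * n) * ∑ Φ, ∑ v, F Φ v ^ 2) := by gcongr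
    _ = 4 * D / η * ∑ Φ, ∑ v, F Φ v ^ 2 := by
        field_simp
        ring

/-- The closing arithmetic of `constLowDegreeHardness_of_noStableSection`: with `T ≤ k²αn + 1`,
`k ≥ 3`, `α ≥ 1`, `n ≥ 1`, the exponent comparison `c₀ T/(4k²α) + c₀ n/4 ≥ c₀ n` is impossible. -/
theorem cld_final_arith {c₀ α k n T : ℝ} (hc₀ : 0 < c₀) (hα1 : 1 ≤ α) (hk3 : 3 ≤ k) (hn1 : 1 ≤ n)
    (hT : T ≤ k ^ 2 * α * n + 1)
    (hkey : -(c₀ / (4 * k ^ 2 * α) * T) + -(c₀ * n / 4) ≤ -(c₀ * n)) : False := by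
  have hk2α1 : (9 : ℝ) ≤ k ^ 2 * α := by
    have h9 : (9 : ℝ) ≤ k ^ 2 := by nlinarith
    nlinarith [mul_le_mul h9 hα1 zero_le_one (by positivity)]
  have hk2αpos : 0 < 4 * k ^ 2 * α := by linarith
  have hdivpos : 0 < c₀ / (4 * k ^ 2 * α) := div_pos hc₀ hk2αpos
  have h3 : c₀ * n - c₀ * n / 4 ≤ c₀ / (4 * k ^ 2 * α) * (k ^ 2 * α * n + 1) := by
    have := mul_le_mul_of_nonneg_left hT hdivpos.le
    linarith
  have h4 : c₀ / (4 * k ^ 2 * α) * (k ^ 2 * α * n + 1) = c₀ * n / 4 + c₀ / (4 * k ^ 2 * α) := by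
    field_simp
  rw [h4] at h3
  have h5 : c₀ / (4 * k ^ 2 * α) ≤ c₀ / 18 := by
    rw [div_le_div_iff₀ hk2αpos (by norm_num)]
    nlinarith [hk2α1, hc₀]
  have hc₀n : c₀ * 1 ≤ c₀ * n := mul_le_mul_of_nonneg_left hn1 hc₀.le
  linarith [h3, h5, hc₀n, hc₀]

/-- **Low-degree hardness of random `k`-SAT at the window density with a CONSTANT failure
probability, modulo `NoStableSection`.** See the module docstring.
[BreslerHuang2022, Thm. 2.6; HuangSellke2025, Lemma 3.1 and Cor. 3.21; ODonnell2014, §8.4] -/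
theorem constLowDegreeHardness_of_noStableSection (hNo : NoStableSection) :
    ∃ k₀ : ℕ, ∀ k : ℕ, k₀ ≤ k → ∃ δ : ℝ, 0 < δ ∧ ∀ C : ℝ, 0 < C → ∀ D : ℕ → ℕ,
      (fun n : ℕ => (D n : ℝ)) =o[atTop] (fun n : ℕ => (n : ℝ) / Real.log n ^ 2) →
      ∀ F : (n : ℕ) → (m : ℕ) → (Fin m → Fin k → Fin n × Bool) → Fin n → ℝ,
        (∀ (n m : ℕ) (v : Fin n), IsCoordDegreeLE (D n)
            (fun y : Fin m × Fin k → Fin n × Bool => F n m (Function.curry y) v)) →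
        (∀ n m : ℕ, m = ⌊5 * 2 ^ k * Real.log k / k * n⌋₊ →
            ∑ Φ : Fin m → Fin k → Fin n × Bool, ∑ v : Fin n, F n m Φ v ^ 2
              ≤ C * n * Fintype.card (Fin m → Fin k → Fin n × Bool)) →
        ∀ᶠ n : ℕ in atTop, ∀ m : ℕ, m = ⌊5 * 2 ^ k * Real.log k / k * n⌋₊ →
          ((univ.filter fun Φ : Fin m → Fin k → Fin n × Bool =>
              (∀ v : Fin n, 1 ≤ |F n m Φ v|) ∧
              ∀ i : Fin m, ∃ j : Fin k, decide (0 ≤ F n m Φ (Φ i j).1) = (Φ i j).2).card : ℝ)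
            ≤ (1 - δ) * Fintype.card (Fin m → Fin k → Fin n × Bool) := by
  obtain ⟨k₀, hk₀⟩ := hNo
  refine ⟨max k₀ 3, fun k hk => ?_⟩
  have hk0 : k₀ ≤ k := le_trans (le_max_left _ _) hk
  have hk3 : 3 ≤ k := le_trans (le_max_right _ _) hk
  obtain ⟨η, hη, ν, hν, c₀, hc₀, hev⟩ := hk₀ k hk0
  have hα1 : (1 : ℝ) ≤ 5 * 2 ^ k * Real.log k / k := smoothMaps_one_le_density hk3
  set α : ℝ := 5 * 2 ^ k * Real.log k / k with hα
  have hαpos : 0 < α := by linarith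
  have hkpos : (0 : ℝ) < k := by exact_mod_cast (by omega : 0 < k)
  have hk3' : (3 : ℝ) ≤ k := by exact_mod_cast hk3
  -- the success ceiling `p⋆ = exp(−c₀/(4k²α))` and `δ = 1 − p⋆`
  set pstar : ℝ := Real.exp (-(c₀ / (4 * k ^ 2 * α))) with hpstar
  have hpstar_pos : 0 < pstar := Real.exp_pos _
  have hpstar_lt : pstar < 1 := Real.exp_lt_one_iff.2 (by
    have : 0 < c₀ / (4 * k ^ 2 * α) := by positivity
    linarith)
  refine ⟨1 - pstar, by linarith, ?_⟩
  intro C hC D hD F hdeg hener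
  -- the degree budget `θ` and its eventuality
  set θ : ℝ := (c₀ * pstar / (24 * k)) ^ 2 * (η / (2 * k * α * C)) with hθ
  have hθpos : 0 < θ := by positivity
  have hDev : ∀ᶠ n : ℕ in atTop, (D n : ℝ) ≤ θ * (n / Real.log n ^ 2) := by
    filter_upwards [hD.def hθpos, eventually_ge_atTop 2] with n hn hn2
    rw [Real.norm_natCast, Real.norm_of_nonneg (by positivity)] at hn
    exact hn
  filter_upwards [hev, hDev, eventually_ge_atTop 2] with n hNSS hDn hn2 m hm
  -- positivity bookkeeping
  have hn1 : 1 ≤ n := by omega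
  have hn1' : (1 : ℝ) ≤ n := by exact_mod_cast hn1
  have hn2' : (2 : ℝ) ≤ n := by exact_mod_cast hn2
  have hlog2 : 0 < Real.log 2 := Real.log_pos (by norm_num)
  have hlogn : Real.log 2 ≤ Real.log n := Real.log_le_log (by norm_num) hn2'
  have hlogpos : 0 < Real.log n := lt_of_lt_of_le hlog2 hlogn
  have hlog4n : Real.log (2 * (2 * n)) ≤ 3 * Real.log n := by
    rw [show (2 : ℝ) * (2 * n) = 2 * 2 * n by ring, Real.log_mul (by norm_num) (by positivity),
      Real.log_mul (by norm_num) (by norm_num)]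
    linarith
  have hmle : (m : ℝ) ≤ α * n := by
    rw [hm, hα]; exact Nat.floor_le (by positivity)
  have hmn : n ≤ m := by rw [hm]; exact smoothMaps_le_numClauses hk3 n
  -- the instance and path counts
  haveI : Nonempty (Fin n × Bool) := ⟨(⟨0, hn1⟩, true)⟩
  set Q : ℝ := (Fintype.card (Fin m → Fin k → Fin n × Bool) : ℝ) with hQ
  have hQpos : 0 < Q := by
    rw [hQ]; exact_mod_cast Fintype.card_pos
  have hPpos : (0 : ℝ) < Fintype.card (Fin (k + 1) → Fin m → Fin k → Fin n × Bool) := by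
    exact_mod_cast Fintype.card_pos
  -- suppose the success set `S` is large
  by_contra hcon
  rw [not_le] at hcon
  set S : Finset (Fin m → Fin k → Fin n × Bool) := univ.filter fun Φ : Fin m → Fin k → Fin n × Bool =>
    (∀ v : Fin n, 1 ≤ |F n m Φ v|) ∧
      ∀ i : Fin m, ∃ j : Fin k, decide (0 ≤ F n m Φ (Φ i j).1) = (Φ i j).2 with hSdef
  have hSbig : pstar * Q < S.card := by
    have : (1 - (1 - pstar)) * Q = pstar * Q := by ring
    rw [← this]; exact hcon
  have hScard_pos : (0 : ℝ) < S.card := lt_trans (mul_pos hpstar_pos hQpos) hSbig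
  have hSne : S.Nonempty := Finset.card_pos.1 (by exact_mod_cast hScard_pos)
  -- the instability relation and its budget
  set Far : (Fin m → Fin k → Fin n × Bool) → (Fin m → Fin k → Fin n × Bool) → Prop :=
    fun Φ Φ' => η * n < ∑ v, (F n m Φ v - F n m Φ' v) ^ 2 with hFar
  have hsymm : ∀ Φ Φ', Far Φ Φ' → Far Φ' Φ := fun Φ Φ' h => by
    simp only [hFar] at h ⊢
    calc η * n < ∑ v, (F n m Φ v - F n m Φ' v) ^ 2 := h
      _ = ∑ v, (F n m Φ' v - F n m Φ v) ^ 2 := Finset.sum_congr rfl fun v _ => by ring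
  have hirr : ∀ Φ, ¬ Far Φ Φ := fun Φ h => by
    simp only [hFar, sub_self] at h
    simp at h
    have : (0 : ℝ) < η * n := by positivity
    linarith
  set B : ℝ := 4 * D n / η * (C * n * Q) with hB
  have hBbound : (∑ a : Fin m, ∑ b : Fin k,
      (((Finset.univ : Finset ((Fin m → Fin k → Fin n × Bool) × (Fin n × Bool))).filter
        fun p => Far p.1 (Function.update p.1 a (Function.update (p.1 a) b p.2))).card : ℝ)) ≤ B := by
    have h := cld_farCount_le hn1 hη (F n m) (hdeg n m)
    refine h.trans ?_
    rw [hB]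
    exact mul_le_mul_of_nonneg_left (hener n m hm) (by positivity)
  -- the scan correlation inequality …
  have hscan := scanCorrelation_paths k m n hn1 S hSne Far hsymm hirr B hBbound
  -- … against the `NoStableSection` ceiling for the sign map
  set g : (Fin m → Fin k → Fin n × Bool) → (Fin n → Bool) := fun Φ v => decide (0 ≤ F n m Φ v)
    with hg
  have hN := hNSS m hm g
  have hsub : ((univ : Finset (Fin (k + 1) → Fin m → Fin k → Fin n × Bool)).filter fun Ψ =>
          (∀ r : Fin k, ∀ q ≤ m * k,
            (fun (a : Fin m) (b : Fin k) =>
              if (a : ℕ) * k + b < q then Ψ r.succ a b else Ψ r.castSucc a b) ∈ S) ∧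
          ∀ r : Fin k, ∀ q < m * k,
            ¬ Far (fun (a : Fin m) (b : Fin k) =>
                if (a : ℕ) * k + b < q then Ψ r.succ a b else Ψ r.castSucc a b)
              (fun (a : Fin m) (b : Fin k) =>
                if (a : ℕ) * k + b < q + 1 then Ψ r.succ a b else Ψ r.castSucc a b)) ⊆
      ((Finset.univ.filter fun Ψ : Fin (k + 1) → Fin m → Fin k → Fin n × Bool =>
          let P : Fin k → ℕ → Fin m → Fin k → Fin n × Bool := fun r q a b =>
            if (a : ℕ) * k + b < q then Ψ r.succ a b else Ψ r.castSucc a b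
          (∀ r : Fin k, ∀ q ≤ m * k, ((Finset.univ.filter fun i : Fin m =>
              ∀ j, g (P r q) (P r q i j).1 ≠ (P r q i j).2).card : ℝ) ≤ ν * m) ∧
          ∀ r : Fin k, ∀ q < m * k, (hammingDist (g (P r q)) (g (P r (q + 1))) : ℝ) ≤ η * n)) := by
    intro Ψ hΨ
    simp only [Finset.mem_filter, Finset.mem_univ, true_and] at hΨ ⊢
    obtain ⟨hval, hstab⟩ := hΨ
    constructor
    · intro r q hq
      have hmem := hval r q hq
      simp only [hSdef, Finset.mem_filter, Finset.mem_univ, true_and] at hmem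
      have hempty : (Finset.univ.filter fun i : Fin m => ∀ j,
          g (fun (a : Fin m) (b : Fin k) =>
              if (a : ℕ) * k + b < q then Ψ r.succ a b else Ψ r.castSucc a b)
            ((fun (a : Fin m) (b : Fin k) =>
              if (a : ℕ) * k + b < q then Ψ r.succ a b else Ψ r.castSucc a b) i j).1 ≠
            ((fun (a : Fin m) (b : Fin k) =>
              if (a : ℕ) * k + b < q then Ψ r.succ a b else Ψ r.castSucc a b) i j).2) = ∅ :=
        Finset.filter_eq_empty_iff.2 fun i _ hi => by
          obtain ⟨j, hj⟩ := hmem.2 i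
          exact hi j hj
      rw [hempty, Finset.card_empty, Nat.cast_zero]
      positivity
    · intro r q hq
      have hmem := hval r q hq.le
      simp only [hSdef, Finset.mem_filter, Finset.mem_univ, true_and] at hmem
      have hfar := hstab r q hq
      simp only [hFar, not_lt] at hfar
      exact (wld_hammingDist_le_sum_sq hmem.1).trans hfar
  have hcard := Finset.card_le_card hsub
  have hchain : (Fintype.card (Fin (k + 1) → Fin m → Fin k → Fin n × Bool) : ℝ) *
      ((S.card : ℝ) / Q) ^ (k * (m * k) + 1) *
      Real.exp (-(2 * Real.log (2 * (2 * n)) / S.card * Real.sqrt ((2 * n : ℝ) ^ (m * k) / (2 * n)) *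
        Real.sqrt ((k * (m * k) : ℕ) * (k * B)))) ≤
      Fintype.card (Fin (k + 1) → Fin m → Fin k → Fin n × Bool) * Real.exp (-(c₀ * n)) :=
    hscan.trans ((Nat.cast_le.2 hcard).trans (hN.trans_eq (mul_comm _ _)))
  -- the defect is at most `c₀ n / 4`
  have hn0 : (n : ℝ) ≠ 0 := by positivity
  have hk0' : (k : ℝ) ≠ 0 := hkpos.ne'
  have hα0 : α ≠ 0 := hαpos.ne'
  have hC0 : C ≠ 0 := hC.ne'
  have hη0 : η ≠ 0 := hη.ne'
  have hlog0 : Real.log n ≠ 0 := hlogpos.ne'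
  have hS0 : (S.card : ℝ) ≠ 0 := hScard_pos.ne'
  have hQeq : Q = (2 * n : ℝ) ^ (m * k) := by
    rw [hQ, Summit.PneNP.PneNP.Cruxes.SolvableImpliesStableSection.Sketch.eng_card_Inst]
    push_cast; ring
  have hinside : (2 * n : ℝ) ^ (m * k) / (2 * n) * ((k * (m * k) : ℕ) * (k * B)) ≤
      (Q * n * (c₀ * pstar) / (24 * Real.log n)) ^ 2 := by
    have hkm : ((k * (m * k) : ℕ) : ℝ) ≤ k * (k * (α * n)) := by
      push_cast
      have : (k : ℝ) * ((m : ℝ) * k) ≤ k * ((α * n) * k) :=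
        mul_le_mul_of_nonneg_left (mul_le_mul_of_nonneg_right hmle hkpos.le) hkpos.le
      linarith [this]
    have hBle : B ≤ 4 * (θ * (n / Real.log n ^ 2)) / η * (C * n * Q) := by
      rw [hB]
      exact mul_le_mul_of_nonneg_right (div_le_div_of_nonneg_right
        (mul_le_mul_of_nonneg_left hDn (by norm_num)) hη.le) (by positivity)
    have hB0 : 0 ≤ B := by rw [hB]; positivity
    calc (2 * n : ℝ) ^ (m * k) / (2 * n) * ((k * (m * k) : ℕ) * (k * B))
        ≤ (2 * n : ℝ) ^ (m * k) / (2 * n) * ((k * (k * (α * n))) *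
            (k * (4 * (θ * (n / Real.log n ^ 2)) / η * (C * n * Q)))) := by
          gcongr
      _ = (Q * n * (c₀ * pstar) / (24 * Real.log n)) ^ 2 := by
          rw [← hQeq, hθ]
          field_simp
          ring
  have hE : 2 * Real.log (2 * (2 * n)) / S.card * Real.sqrt ((2 * n : ℝ) ^ (m * k) / (2 * n)) *
      Real.sqrt ((k * (m * k) : ℕ) * (k * B)) ≤ c₀ * n / 4 := by
    have hM0 : 0 ≤ Q * n * (c₀ * pstar) / (24 * Real.log n) := by positivity
    have hsq : Real.sqrt ((2 * n : ℝ) ^ (m * k) / (2 * n)) *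
        Real.sqrt ((k * (m * k) : ℕ) * (k * B)) ≤ Q * n * (c₀ * pstar) / (24 * Real.log n) := by
      rw [← Real.sqrt_mul (by positivity)]
      calc Real.sqrt ((2 * n : ℝ) ^ (m * k) / (2 * n) * ((k * (m * k) : ℕ) * (k * B)))
          ≤ Real.sqrt ((Q * n * (c₀ * pstar) / (24 * Real.log n)) ^ 2) := Real.sqrt_le_sqrt hinside
        _ = Q * n * (c₀ * pstar) / (24 * Real.log n) := Real.sqrt_sq hM0
    have hlogS : 2 * Real.log (2 * (2 * n)) / S.card ≤ 6 * Real.log n / S.card :=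
      div_le_div_of_nonneg_right (by linarith) hScard_pos.le
    have hpos1 : 0 ≤ 2 * Real.log (2 * (2 * n)) / S.card :=
      div_nonneg (mul_nonneg (by norm_num) (Real.log_nonneg (by linarith))) hScard_pos.le
    calc 2 * Real.log (2 * (2 * n)) / S.card * Real.sqrt ((2 * n : ℝ) ^ (m * k) / (2 * n)) *
          Real.sqrt ((k * (m * k) : ℕ) * (k * B))
        = 2 * Real.log (2 * (2 * n)) / S.card * (Real.sqrt ((2 * n : ℝ) ^ (m * k) / (2 * n)) *
            Real.sqrt ((k * (m * k) : ℕ) * (k * B))) := by ring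
      _ ≤ (6 * Real.log n / S.card) * (Q * n * (c₀ * pstar) / (24 * Real.log n)) :=
          mul_le_mul hlogS hsq (by positivity) (by positivity)
      _ = (c₀ * n / 4) * (pstar * Q / S.card) := by
          field_simp
          ring
      _ ≤ (c₀ * n / 4) * 1 := by
          refine mul_le_mul_of_nonneg_left ?_ (by positivity)
          rw [div_le_one hScard_pos]
          exact hSbig.le
      _ = c₀ * n / 4 := mul_one _
  -- the success factor is at least `p⋆^{k²m+1} = exp(−c₀ (k²m+1)/(4k²α))`
  have hp : pstar ≤ (S.card : ℝ) / Q := by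
    rw [le_div_iff₀ hQpos]; exact hSbig.le
  have hpow : pstar ^ (k * (m * k) + 1) ≤ ((S.card : ℝ) / Q) ^ (k * (m * k) + 1) :=
    pow_le_pow_left₀ hpstar_pos.le hp _
  have hpow_eq : pstar ^ (k * (m * k) + 1) =
      Real.exp (-(c₀ / (4 * k ^ 2 * α)) * ((k * (m * k) + 1 : ℕ) : ℝ)) := by
    rw [hpstar, ← Real.exp_nat_mul]; ring_nf
  -- compare exponents
  have hkey : Real.exp (-(c₀ / (4 * k ^ 2 * α)) * ((k * (m * k) + 1 : ℕ) : ℝ)) *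
      Real.exp (-(c₀ * n / 4)) ≤ Real.exp (-(c₀ * n)) := by
    have h1 : (Fintype.card (Fin (k + 1) → Fin m → Fin k → Fin n × Bool) : ℝ) *
        (Real.exp (-(c₀ / (4 * k ^ 2 * α)) * ((k * (m * k) + 1 : ℕ) : ℝ)) *
          Real.exp (-(c₀ * n / 4))) ≤
        (Fintype.card (Fin (k + 1) → Fin m → Fin k → Fin n × Bool) : ℝ) *
          (((S.card : ℝ) / Q) ^ (k * (m * k) + 1) *
            Real.exp (-(2 * Real.log (2 * (2 * n)) / S.card *
              Real.sqrt ((2 * n : ℝ) ^ (m * k) / (2 * n)) *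
              Real.sqrt ((k * (m * k) : ℕ) * (k * B))))) := by
      refine mul_le_mul_of_nonneg_left ?_ hPpos.le
      rw [← hpow_eq]
      have hexpE : Real.exp (-(c₀ * n / 4)) ≤ Real.exp (-(2 * Real.log (2 * (2 * n)) / S.card *
          Real.sqrt ((2 * n : ℝ) ^ (m * k) / (2 * n)) * Real.sqrt ((k * (m * k) : ℕ) * (k * B)))) :=
        Real.exp_le_exp.2 (neg_le_neg hE)
      exact mul_le_mul hpow hexpE (Real.exp_pos _).le (pow_nonneg (div_nonneg hScard_pos.le hQpos.le) _)
    rw [mul_assoc] at hchain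
    exact le_of_mul_le_mul_left (h1.trans hchain) hPpos
  rw [← Real.exp_add, Real.exp_le_exp, neg_mul] at hkey
  -- arithmetic contradiction: `T + 1 = k²m + 1 ≤ k²αn + 1 < 3k²αn`
  have hT : ((k * (m * k) + 1 : ℕ) : ℝ) ≤ k ^ 2 * α * n + 1 := by
    have h1 : (k : ℝ) * ((m : ℝ) * k) ≤ k * ((α * n) * k) :=
      mul_le_mul_of_nonneg_left (mul_le_mul_of_nonneg_right hmle hkpos.le) hkpos.le
    have h2 : (k : ℝ) * ((α * n) * k) = k ^ 2 * α * n := by ring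
    push_cast
    linarith only [h1, h2]
  exact cld_final_arith hc₀ hα1 hk3' hn1' hT hkey

end Summit.PneNP.PneNP.Theorems
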